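import Summits.HubbardSuperconductivity.HubbardLadder.Bounds.ConnectedBondSetDecomposition
import HarnessLib

/-!
# Entropy of connected bond sets: the Catalan recursion

HONEST FRAMING (cell pub-hubbard): ladder R1–R4 with certified numbers; no claim on H/H₀. This file
proves bounds for model classes (polymer combinatorics / activities of Hubbard-type lattice fermions),
no materials claim. LEAN FILING REQUEST #195 part 2 of 5 (bounds g25); generic, imports part 1 only.

For a finite set `D` of directed spin-bonds, non-negative bond weights `w_b`, a site weight `e^{a}`
per site (`a ≥ 0`) and a bound `W` on the *weighted degree* `Σ_{b ∈ D, v ∈ verts b} w_b ≤ W` of every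
site, we prove the **tree-graph (Catalan) entropy bound** for the `ShareVertex`-connected subsets of
`D` through a site (`sum_prod_mul_exp_card_cellSupp_le`):

  if `e^{a} + W F² ≤ F` then `Σ_{X ⊆ D connected, v ∈ supp X} (∏_{b ∈ X} w_b) e^{a |supp X|} ≤ F - e^{a}`.

The smallest admissible `F` is `e^{a} c(W e^{a})` with `c(s) = (1 - √(1-4s))/(2s)` the Catalan
generating function, so the bound reads `Σ ≤ e^{a} 𝓒(W e^{a})`, `𝓒 = c - 1` — the entropy lemma of
the high-temperature Kotecký–Preiss argument (paper `bounds.tex` §12, Lemma 12.4), here WITHOUT the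
spanning-tree / plane-tree counting and without a loop factor: the proof is a direct recursion on the
number of bonds. Removing a chosen bond `b₀ ∋ v` from a connected `X` leaves the component `X₁` through
`v` and the component `X₂` through the other endpoint `u` of `b₀` (empty, or equal to `X₁`, allowed),
`X = {b₀} ⊔ X₁ ⊔ X₂`, `|supp X| ≤ |{v} ∪ supp X₁| + |{u} ∪ supp X₂|` (part 1); hence with
`Θ_N(v) = e^{a} + Σ_{|X| ≤ N} …` (`anchoredSum`) one gets
`Θ_{N+1}(v) ≤ e^{a} + W Θ_N(v) Θ_N(u) ≤ e^{a} + W F² ≤ F` by induction on `N`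
(`sum_anchoredWeight_succ_le`, `anchoredSum_le`).

Compared with the tree's lattice-animal count `(2m+1)^{2|X|}`
(`Literature.MathematicalPhysics.QuantumLattice.sum_norm_couplingActivity_mul_exp_le`) the constant
per bond is the weighted degree `W` instead of `e · (max degree) · (max weight)`. [folklore:
KoteckyPreiss1986 condition (1) via the tree-graph bound]

Tree / Mathlib search: `Finset.sum_sigma`, `Finset.sum_image`, `Finset.sum_le_sum_of_subset_of_nonneg`;
no tree lemma counts connected cell sets by a tree recursion (`LatticeAnimals*` count by cardinality).

References: R. Kotecký, D. Preiss, Comm. Math. Phys. 103 (1986) 491 [KoteckyPreiss1986];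
D. Ueltschi, J. Stat. Phys. 95 (1999) 693 (arXiv:cond-mat/9810320), §2.3 [Ueltschi1999].
-/

noncomputable section

namespace Summit.HubbardSuperconductivity.HubbardLadder.Bounds

open Finset Literature.Probability.LatticeModels Literature.MathematicalPhysics.QuantumLattice

variable {Λ : Type*} [DecidableEq Λ]

/-! ### The anchored sums `Θ_N(v)` and the recursion -/

section Recursion

variable (D : Finset (Bond Λ)) (w : Bond Λ → ℝ) (a : ℝ)

/-- `φ_y(Z) = (∏_{b ∈ Z} w_b) · e^{a |{y} ∪ supp Z|}` (so `φ_y(∅) = e^{a}`). [folklore] -/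
def anchoredWeight (y : Λ) (Z : Finset (Bond Λ)) : ℝ :=
  (∏ b ∈ Z, w b) * Real.exp (a * ((insert y (cellSupp Bond.verts Z)).card : ℝ))

/-- The family `{∅} ∪ {Z ⊆ D connected : y ∈ supp Z, |Z| ≤ N}`. [folklore] -/
def anchoredFamily (N : ℕ) (y : Λ) : Finset (Finset (Bond Λ)) :=
  insert ∅ ((connectedCellSets Bond.verts D).filter fun Z => y ∈ cellSupp Bond.verts Z ∧ Z.card ≤ N)

/-- `Θ_N(y) = Σ_{Z ∈ anchoredFamily N y} φ_y(Z)`. [folklore] -/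
def anchoredSum (N : ℕ) (y : Λ) : ℝ := ∑ Z ∈ anchoredFamily D N y, anchoredWeight w a y Z

variable {D w a}

/-- Auxiliary lemma `empty_notMem_filter_connectedCellSets` (support step for the results of this file; see the module docstring). -/
theorem empty_notMem_filter_connectedCellSets (p : Finset (Bond Λ) → Prop) [DecidablePred p] :
    (∅ : Finset (Bond Λ)) ∉ (connectedCellSets Bond.verts D).filter p := fun h =>
  Finset.not_nonempty_empty (mem_connectedCellSets.1 (Finset.mem_filter.1 h).1).2.1

/-- Auxiliary lemma `anchoredWeight_empty` (support step for the results of this file; see the module docstring). -/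
theorem anchoredWeight_empty (y : Λ) : anchoredWeight w a y ∅ = Real.exp a := by
  simp [anchoredWeight]

/-- Auxiliary lemma `anchoredSum_eq` (support step for the results of this file; see the module docstring). -/
theorem anchoredSum_eq (N : ℕ) (y : Λ) :
    anchoredSum D w a N y = Real.exp a +
      ∑ Z ∈ (connectedCellSets Bond.verts D).filter (fun Z => y ∈ cellSupp Bond.verts Z ∧ Z.card ≤ N),
        anchoredWeight w a y Z := by
  rw [anchoredSum, anchoredFamily, Finset.sum_insert (empty_notMem_filter_connectedCellSets _), anchoredWeight_empty]

/-- Auxiliary lemma `anchoredWeight_nonneg` (support step for the results of this file; see the module docstring). -/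
theorem anchoredWeight_nonneg (hw : ∀ b ∈ D, 0 ≤ w b) {Z : Finset (Bond Λ)} (hZ : Z ⊆ D) (y : Λ) :
    0 ≤ anchoredWeight w a y Z :=
  mul_nonneg (Finset.prod_nonneg fun b hb => hw b (hZ hb)) (Real.exp_nonneg _)

/-- Auxiliary lemma `mem_anchoredFamily` (support step for the results of this file; see the module docstring). -/
theorem mem_anchoredFamily {N : ℕ} {y : Λ} {Z : Finset (Bond Λ)} :
    Z ∈ anchoredFamily D N y ↔ Z = ∅ ∨ (Z ∈ connectedCellSets Bond.verts D ∧ y ∈ cellSupp Bond.verts Z ∧ Z.card ≤ N) := by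
  rw [anchoredFamily, Finset.mem_insert, Finset.mem_filter]

/-- Auxiliary lemma `subset_of_mem_anchoredFamily` (support step for the results of this file; see the module docstring). -/
theorem subset_of_mem_anchoredFamily {N : ℕ} {y : Λ} {Z : Finset (Bond Λ)} (hZ : Z ∈ anchoredFamily D N y) : Z ⊆ D := by
  rcases mem_anchoredFamily.1 hZ with rfl | ⟨h, -, -⟩
  · exact Finset.empty_subset _
  · exact (mem_connectedCellSets.1 h).1

/-- Auxiliary lemma `anchoredSum_nonneg` (support step for the results of this file; see the module docstring). -/
theorem anchoredSum_nonneg (hw : ∀ b ∈ D, 0 ≤ w b) (N : ℕ) (y : Λ) : 0 ≤ anchoredSum D w a N y :=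
  Finset.sum_nonneg fun _ hZ => anchoredWeight_nonneg hw (subset_of_mem_anchoredFamily hZ) y

/-- Auxiliary lemma `mem_anchoredFamily_of` (support step for the results of this file; see the module docstring). -/
theorem mem_anchoredFamily_of {N : ℕ} {y : Λ} {Z : Finset (Bond Λ)} (hZD : Z ⊆ D) (hcard : Z.card ≤ N)
    (h : Z = ∅ ∨ (IsRConnected (ShareVertex Bond.verts) Z ∧ y ∈ cellSupp Bond.verts Z)) :
    Z ∈ anchoredFamily D N y := by
  rcases h with h | ⟨hc, hy⟩
  · exact mem_anchoredFamily.2 (Or.inl h)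
  · exact mem_anchoredFamily.2 (Or.inr ⟨mem_connectedCellSets.2 ⟨hZD, hc⟩, hy, hcard⟩)

/-- **The recursion step**: `Σ_{X connected, v ∈ supp X, |X| ≤ N+1} φ_v(X) ≤ Σ_{b₀ ∈ D, v ∈ b₀} w_{b₀} Θ_N(v) Θ_N(u(b₀))`.
[folklore] -/
theorem sum_anchoredWeight_succ_le (hw : ∀ b ∈ D, 0 ≤ w b) (ha : 0 ≤ a) (N : ℕ) (v : Λ) :
    ∑ X ∈ (connectedCellSets Bond.verts D).filter (fun X => v ∈ cellSupp Bond.verts X ∧ X.card ≤ N + 1),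
        anchoredWeight w a v X ≤
      ∑ b₀ ∈ D.filter (fun b => v ∈ Bond.verts b),
        w b₀ * (anchoredSum D w a N v * anchoredSum D w a N (otherEnd v b₀)) := by
  classical
  set 𝒮 := (connectedCellSets Bond.verts D).filter (fun X => v ∈ cellSupp Bond.verts X ∧ X.card ≤ N + 1) with h𝒮
  set Dv := D.filter (fun b => v ∈ Bond.verts b) with hDv
  -- the chosen bond of `X` through `v`
  have hex : ∀ X ∈ 𝒮, ∃ b ∈ X, v ∈ Bond.verts b := fun X hX =>
    mem_cellSupp.1 (Finset.mem_filter.1 hX).2.1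
  set ch : Finset (Bond Λ) → Bond Λ := fun X =>
    if h : ∃ b ∈ X, v ∈ Bond.verts b then h.choose else (v, v, 0) with hch
  have hch_spec : ∀ X ∈ 𝒮, ch X ∈ X ∧ v ∈ Bond.verts (ch X) := fun X hX => by
    simp only [hch, dif_pos (hex X hX)]; exact (hex X hX).choose_spec
  -- the decomposition map and the target index set
  set Ψ : Finset (Bond Λ) → (Σ _ : Bond Λ, Finset (Bond Λ) × Finset (Bond Λ)) :=
    fun X => ⟨ch X, (vcomp (X.erase (ch X)) v, piece₂ X (ch X) v)⟩ with hΨ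
  set P : Finset (Σ _ : Bond Λ, Finset (Bond Λ) × Finset (Bond Λ)) :=
    Dv.sigma (fun b₀ => anchoredFamily D N v ×ˢ anchoredFamily D N (otherEnd v b₀)) with hP
  set g : (Σ _ : Bond Λ, Finset (Bond Λ) × Finset (Bond Λ)) → ℝ :=
    fun p => w p.1 * (anchoredWeight w a v p.2.1 * anchoredWeight w a (otherEnd v p.1) p.2.2) with hg
  have hRHS : ∑ b₀ ∈ Dv, w b₀ * (anchoredSum D w a N v * anchoredSum D w a N (otherEnd v b₀)) = ∑ p ∈ P, g p := by
    rw [hP, Finset.sum_sigma]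
    refine Finset.sum_congr rfl fun b₀ _ => ?_
    rw [anchoredSum, anchoredSum, Finset.sum_mul_sum, Finset.mul_sum, Finset.sum_product]
    refine Finset.sum_congr rfl fun Z₁ _ => ?_
    rw [Finset.mul_sum]
  -- properties of the decomposition
  have hconn : ∀ X ∈ 𝒮, IsRConnected (ShareVertex Bond.verts) X := fun X hX =>
    (mem_connectedCellSets.1 (Finset.mem_filter.1 hX).1).2
  have hXD : ∀ X ∈ 𝒮, X ⊆ D := fun X hX => (mem_connectedCellSets.1 (Finset.mem_filter.1 hX).1).1
  have hmaps : ∀ X ∈ 𝒮, Ψ X ∈ P := by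
    intro X hX
    obtain ⟨hb₀, hvb₀⟩ := hch_spec X hX
    have hcard : (X.erase (ch X)).card ≤ N := by
      have := Finset.card_erase_of_mem hb₀
      have hXc : X.card ≤ N + 1 := (Finset.mem_filter.1 hX).2.2
      omega
    have hsub : X.erase (ch X) ⊆ D := (Finset.erase_subset _ _).trans (hXD X hX)
    refine Finset.mem_sigma.2 ⟨Finset.mem_filter.2 ⟨hXD X hX hb₀, hvb₀⟩, Finset.mem_product.2 ⟨?_, ?_⟩⟩
    · exact mem_anchoredFamily_of ((vcomp_subset _ _).trans hsub)
        ((Finset.card_le_card (vcomp_subset _ _)).trans hcard) (vcomp_eq_empty_or _ _)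
    · exact mem_anchoredFamily_of ((piece₂_subset _ _ _).trans hsub)
        ((Finset.card_le_card (piece₂_subset _ _ _)).trans hcard) (piece₂_eq_empty_or _ _ _)
  have hinj : Set.InjOn Ψ 𝒮 := by
    intro X hX Y hY hXY
    simp only [hΨ] at hXY
    obtain ⟨hb, hrest⟩ := Sigma.mk.inj_iff.1 hXY
    have hrest' := eq_of_heq hrest
    rw [Prod.mk.injEq] at hrest'
    obtain ⟨h1, h2⟩ := hrest'
    calc X = insert (ch X) (vcomp (X.erase (ch X)) v ∪ piece₂ X (ch X) v) :=
          eq_insert_vcomp_union_piece₂ (hconn X hX) (hch_spec X hX).1 (hch_spec X hX).2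
      _ = insert (ch Y) (vcomp (Y.erase (ch Y)) v ∪ piece₂ Y (ch Y) v) := by rw [h1, h2, hb]
      _ = Y := (eq_insert_vcomp_union_piece₂ (hconn Y hY) (hch_spec Y hY).1 (hch_spec Y hY).2).symm
  have hterm : ∀ X ∈ 𝒮, anchoredWeight w a v X ≤ g (Ψ X) := by
    intro X hX
    obtain ⟨hb₀, hvb₀⟩ := hch_spec X hX
    have hvX : v ∈ cellSupp Bond.verts X := (Finset.mem_filter.1 hX).2.1
    simp only [hg, hΨ, anchoredWeight]
    rw [Finset.insert_eq_of_mem hvX, prod_eq_mul_prod_prod w (hconn X hX) hb₀ hvb₀]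
    have hw0 : 0 ≤ w (ch X) := hw _ (hXD X hX hb₀)
    have hp1 : 0 ≤ ∏ b ∈ vcomp (X.erase (ch X)) v, w b :=
      Finset.prod_nonneg fun b hb => hw b (hXD X hX (Finset.mem_of_mem_erase (vcomp_subset _ _ hb)))
    have hp2 : 0 ≤ ∏ b ∈ piece₂ X (ch X) v, w b :=
      Finset.prod_nonneg fun b hb => hw b (hXD X hX (Finset.mem_of_mem_erase (piece₂_subset _ _ _ hb)))
    have hexp : Real.exp (a * ((cellSupp Bond.verts X).card : ℝ)) ≤
        Real.exp (a * ((insert v (cellSupp Bond.verts (vcomp (X.erase (ch X)) v))).card : ℝ)) *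
          Real.exp (a * ((insert (otherEnd v (ch X)) (cellSupp Bond.verts (piece₂ X (ch X) v))).card : ℝ)) := by
      rw [← Real.exp_add, Real.exp_le_exp, ← mul_add]
      refine mul_le_mul_of_nonneg_left ?_ ha
      exact_mod_cast card_cellSupp_le_add (hconn X hX) hb₀ hvb₀
    calc w (ch X) * ((∏ b ∈ vcomp (X.erase (ch X)) v, w b) * ∏ b ∈ piece₂ X (ch X) v, w b) *
          Real.exp (a * ((cellSupp Bond.verts X).card : ℝ))
        ≤ w (ch X) * ((∏ b ∈ vcomp (X.erase (ch X)) v, w b) * ∏ b ∈ piece₂ X (ch X) v, w b) *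
          (Real.exp (a * ((insert v (cellSupp Bond.verts (vcomp (X.erase (ch X)) v))).card : ℝ)) *
            Real.exp (a * ((insert (otherEnd v (ch X)) (cellSupp Bond.verts (piece₂ X (ch X) v))).card : ℝ))) :=
          mul_le_mul_of_nonneg_left hexp (by positivity)
      _ = _ := by ring
  have hg0 : ∀ p ∈ P, 0 ≤ g p := by
    intro p hp
    obtain ⟨hb, hZ⟩ := Finset.mem_sigma.1 hp
    obtain ⟨hZ1, hZ2⟩ := Finset.mem_product.1 hZ
    exact mul_nonneg (hw _ (Finset.mem_filter.1 hb).1)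
      (mul_nonneg (anchoredWeight_nonneg hw (subset_of_mem_anchoredFamily hZ1) _)
        (anchoredWeight_nonneg hw (subset_of_mem_anchoredFamily hZ2) _))
  rw [hRHS]
  calc ∑ X ∈ 𝒮, anchoredWeight w a v X ≤ ∑ X ∈ 𝒮, g (Ψ X) := Finset.sum_le_sum hterm
    _ = ∑ p ∈ 𝒮.image Ψ, g p := (Finset.sum_image hinj).symm
    _ ≤ ∑ p ∈ P, g p :=
        Finset.sum_le_sum_of_subset_of_nonneg (Finset.image_subset_iff.2 hmaps) fun p hp _ => hg0 p hp

/-- **The Catalan recursion**: if `e^{a} + W F² ≤ F` then `Θ_N(v) ≤ F` for all `N, v`. [folklore] -/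
theorem anchoredSum_le (hw : ∀ b ∈ D, 0 ≤ w b) (ha : 0 ≤ a) {W F : ℝ}
    (hW : ∀ v : Λ, ∑ b ∈ D.filter (fun b => v ∈ Bond.verts b), w b ≤ W) (hF : Real.exp a + W * F ^ 2 ≤ F) :
    ∀ (N : ℕ) (v : Λ), anchoredSum D w a N v ≤ F := by
  intro N
  induction N with
  | zero =>
    intro v
    have hW0 : 0 ≤ W := (Finset.sum_nonneg fun b hb => hw b (Finset.mem_filter.1 hb).1).trans (hW v)
    have h0 : ((connectedCellSets Bond.verts D).filter
        (fun Z => v ∈ cellSupp Bond.verts Z ∧ Z.card ≤ 0)) = ∅ := by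
      refine Finset.filter_eq_empty_iff.2 fun Z hZ h => ?_
      have hne := (mem_connectedCellSets.1 hZ).2.1
      rw [← Finset.card_pos] at hne
      omega
    rw [anchoredSum_eq, h0, Finset.sum_empty, add_zero]
    nlinarith [sq_nonneg F]
  | succ N ih =>
    intro v
    have hW0 : 0 ≤ W := (Finset.sum_nonneg fun b hb => hw b (Finset.mem_filter.1 hb).1).trans (hW v)
    have hFexp : Real.exp a ≤ F := by nlinarith [sq_nonneg F]
    have hF0 : 0 ≤ F := (Real.exp_pos a).le.trans hFexp
    rw [anchoredSum_eq]
    refine le_trans (add_le_add le_rfl (sum_anchoredWeight_succ_le hw ha N v)) ?_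
    calc Real.exp a + ∑ b₀ ∈ D.filter (fun b => v ∈ Bond.verts b),
          w b₀ * (anchoredSum D w a N v * anchoredSum D w a N (otherEnd v b₀))
        ≤ Real.exp a + ∑ b₀ ∈ D.filter (fun b => v ∈ Bond.verts b), w b₀ * F ^ 2 := by
          refine add_le_add le_rfl (Finset.sum_le_sum fun b₀ hb₀ => ?_)
          refine mul_le_mul_of_nonneg_left ?_ (hw b₀ (Finset.mem_filter.1 hb₀).1)
          rw [sq]
          exact mul_le_mul (ih v) (ih _) (anchoredSum_nonneg hw N _) hF0
      _ = Real.exp a + (∑ b₀ ∈ D.filter (fun b => v ∈ Bond.verts b), w b₀) * F ^ 2 := by rw [Finset.sum_mul]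
      _ ≤ Real.exp a + W * F ^ 2 := by
          exact add_le_add le_rfl (mul_le_mul_of_nonneg_right (hW v) (sq_nonneg F))
      _ ≤ F := hF

/-- **THEOREM (Catalan entropy bound for connected bond sets through a site).** For bond weights
`w ≥ 0` on `D` with weighted degree `Σ_{b ∈ D, v ∈ b} w_b ≤ W` at every site, `a ≥ 0`, and any `F`
with `e^{a} + W F² ≤ F`:
`Σ_{X ⊆ D connected, v ∈ supp X} (∏_{b∈X} w_b) e^{a |supp X|} ≤ F - e^{a}`. [folklore; the form of bounds.tex Lemma 12.4] -/
theorem sum_prod_mul_exp_card_cellSupp_le (hw : ∀ b ∈ D, 0 ≤ w b) (ha : 0 ≤ a) {W F : ℝ}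
    (hW : ∀ v : Λ, ∑ b ∈ D.filter (fun b => v ∈ Bond.verts b), w b ≤ W) (hF : Real.exp a + W * F ^ 2 ≤ F)
    (v : Λ) :
    ∑ X ∈ (connectedCellSets Bond.verts D).filter (fun X => v ∈ cellSupp Bond.verts X),
        (∏ b ∈ X, w b) * Real.exp (a * ((cellSupp Bond.verts X).card : ℝ)) ≤ F - Real.exp a := by
  have h := anchoredSum_le hw ha hW hF D.card v
  rw [anchoredSum_eq] at h
  have hset : (connectedCellSets Bond.verts D).filter (fun X => v ∈ cellSupp Bond.verts X) =
      (connectedCellSets Bond.verts D).filter (fun X => v ∈ cellSupp Bond.verts X ∧ X.card ≤ D.card) := by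
    refine Finset.filter_congr fun X hX => ?_
    have := Finset.card_le_card (mem_connectedCellSets.1 hX).1
    tauto
  rw [hset]
  have hterm : ∀ X ∈ (connectedCellSets Bond.verts D).filter (fun X => v ∈ cellSupp Bond.verts X ∧ X.card ≤ D.card),
      (∏ b ∈ X, w b) * Real.exp (a * ((cellSupp Bond.verts X).card : ℝ)) = anchoredWeight w a v X := by
    intro X hX
    rw [anchoredWeight, Finset.insert_eq_of_mem (Finset.mem_filter.1 hX).2.1]
  rw [Finset.sum_congr rfl hterm]
  linarith

end Recursion

end Summit.HubbardSuperconductivity.HubbardLadder.Bounds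

end
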